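import Literature.AlgebraicGeometry.Deformation.LocalHilbertFunctorAnyHullDimensionBound
import Literature.AlgebraicGeometry.Deformation.LocalHilbertFunctorAnyHullComponentDimensionBound
import Literature.AlgebraicGeometry.Deformation.LocalHilbertFunctorKernelPrinciple
import HarnessLib

/-!
# The KERNEL PRINCIPLE for EVERY hull of `H_Z^X`: a compatible map `θ : H¹(Z, 𝒩_{Z/X}) → W` towards the obstruction theory of an
# UNOBSTRUCTED functor gives `h⁰(𝒩) ≤ dim R′ + dim ker θ` for every hull `R′` and every irreducible component, and `θ` injective ⇒ `dim R′ = h⁰(𝒩)`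

Layer `Literature/AlgebraicGeometry/Deformation` (family `hodge`; literature-typing tranche LT-H1 «semiregularity consumers», cell `pub-hsemireg`,
Ventures-side typer #2; census §6 (ii)/(iv) and item (c)). THEOREMS only (0 definitions, 0 named facts, no `sorry`, no instance, no notation):
ONE-LINE corollaries of the tree's `LocalHilbertFunctorAnyHullDimensionBound` / `LocalHilbertFunctorAnyHullComponentDimensionBound` (bounds for every
abstract hull `Formal.IsHull`, [Schlessinger1968, Def. 2.7 / Prop. 2.9]) with their bare kernel HYPOTHESIS `(θ ⊗ 1)(ob) = 0` DISCHARGED by the tree's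
kernel principle (`LocalHilbertFunctorKernelPrinciple`, `localHilbertFunctor_annihilates_of_isCompatible`; [IaconoManetti2013SemiregularityCI, §6]
«the obstructions of the functor … are contained in the kernel of the induced map»; tree `ObstructionTheory.IsCompatible.rTensor_ob_eq_zero_of_isSmoothSmall`).

## Sources, verbatim

* [IaconoManetti2013SemiregularityCI] Adv. Math. 235 (2013), Introduction (p. 2) «if the semiregularity map is injective, then the Hilbert scheme … is
  smooth at `Z`»; §6 (p. 14) (morphism to an unobstructed functor + compatible obstruction theories).
* [Manetti1999DeformationTheoryDGLA] Def. 2.14 / p. 9 («`w_e φ = φ′ v_e`»), Prop. 2.17, Prop. 2.18.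
* [BuchweitzFlenner2003] Thm. 7.9 (2) [arXiv p0034:L1–3] «If `Z` is compact then `dim_{[Z]} H_X ≥ dim_ℂ T¹_{X/Z}(𝒪_Z) − dim_ℂ ker τ`. In particular, if `τ` is
  injective then `H_X` is smooth at `[Z]`»; Rem. 7.11 (1).
* [Ran1993HodgeHilbertScheme] (3) + Cor. 2 «for any component `ℋ` of `Hilb_X` through `{Y}`».
* [Schlessinger1968] Def. 2.7, Prop. 2.9 (p. 211), Remark 2.10 (p. 212); [Hartshorne2010] Thm. 11.3 [p0101:L11–13], §15 Ex. 15.5 (b) [p0126:L9], Cor. 9.3, §17.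

## What this file proves (`Z ⊂ X` a PROPER regular immersion of constant codimension `c` into a locally Noetherian `k`-scheme, `Z ≠ ∅`; `(R′, ξ̂′)` ANY hull
## of `H_Z^X`; `G` ANY functor with `G.IsSmoothSmall`, `ν : ∀ R, H_Z^X(R) → G(R)`, `(W, w_e)` ANY obstruction theory of `G`, `θ : H¹(Z, 𝒩_{Z/X}) → W` compatible)

* **`localHilbertFunctor_isHull_dimension_bound_of_isCompatible`** — `dim_k ker θ < ∞` ⇒ **`h⁰(Z, 𝒩_{Z/X}) ≤ dim R′ + dim_k ker θ`** ([BuchweitzFlenner2003, Thm. 7.9 (2)]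
  shape for every hull).
* **`localHilbertFunctor_isHull_ringKrullDim_eq_of_isCompatible_of_injective`** — `θ` injective ⇒ **`dim R′ = h⁰(Z, 𝒩_{Z/X})`** and `H_Z^X` smooth (every hull is then a
  formal power series ring, [Schlessinger1968, Remark 2.10]; tree `localHilbertFunctor_isSmooth_iff_ringKrullDim_hull_eq_normalH0`).
* **`localHilbertFunctor_isHull_component_dimension_bound_of_isCompatible`** — every minimal prime `𝔭` of `R′`: **`h⁰ ≤ dim (R′/𝔭) + dim_k ker θ`**
  ([Ran1993HodgeHilbertScheme, Cor. 2] shape for every hull).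
* **`localHilbertFunctor_isHull_component_dimension_bound_rank_of_isCompatible`** (universe `0`) — the printed rank form **`h⁰ + rk θ ≤ dim (R′/𝔭) + h¹`**.
* §2 `HodgeTheory.localHilbertFunctor_isHull_dimension_bound_of_isCompatible_smoothProjective` — over `ℂ`, `X` smooth projective, `ι₀` a regular immersion of
  codimension `p`: `d = dim R′ ∈ ℕ` with `h⁰ ≤ d + dim ker θ`, and `θ` injective ⇒ `d = h⁰`.

HONEST SCOPE. (1) `G`, `ν`, `(W, w_e)`, `θ` are HYPOTHESES — no semiregularity map, no intermediate-Jacobian ∕ Deligne ∕ Hodge-locus functor, no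
unobstructedness proof is typed (the XL inputs of Bloch (7.3) ∕ BF 7.9 ∕ Ran ∕ BLM Cor. 1.2). (2) `R′` ranges over hulls of the local Hilbert FUNCTOR;
`𝒪̂_{Hilb,[Z]}` = hull and «components of `Hilb` ↔ minimal primes» are not typed. Grade: REFEREED. Nothing here asserts HC ∕ HC_CM ∕ HC_AV ∕ W₆ ∕
HC_Kum4Type, Bloch's theorem, or that any geometric map is compatible ∕ any geometric functor unobstructed.

## References
* [IaconoManetti2013SemiregularityCI] Introduction, §6. [Manetti1999DeformationTheoryDGLA] Def. 2.14, Prop. 2.17, 2.18. [BuchweitzFlenner2003] Thm. 7.9 (2), Rem. 7.11 (1).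
* [Ran1993HodgeHilbertScheme] (3), Cor. 2. [Schlessinger1968] Def. 2.7, Prop. 2.9, Remark 2.10. [Hartshorne2010] Thm. 11.3, Ex. 15.5 (b), Cor. 9.3, §17.
-/

noncomputable section

-- `(X ⊗ T).left = pullback X.hom T.hom` is `rfl` (`Over.tensorObj_left`) only at default transparency; as in the parents
set_option backward.isDefEq.respectTransparency false -- `HilbTangentSheafNormalSheafIso.lean` ∕ Mathlib's `Cartesian.Over`

open CategoryTheory Limits IsLocalRing _root_.AlgebraicGeometry Literature.AlgebraicGeometry.Motives
open scoped TensorProduct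

universe u

namespace Literature.AlgebraicGeometry.Deformation

/-! ## §1 Every hull of `H_Z^X`, `Z` a proper local complete intersection -/

section AnyHull

variable {k : Type u} [Field k] (X : Motives.SchemeOver k) {Z : Scheme.{u}} (ι₀ : Z ⟶ X.left) [IsClosedImmersion ι₀]
  [IsLocallyNoetherian X.left] [IsProper (ι₀ ≫ X.hom)] [Nonempty Z] {c : ℕ} (hreg : HodgeTheory.IsRegularImmersionOfCodim ι₀ c)
  (R' : Type u) [CommRing R'] [Algebra k R'] [IsLocalRing R'] [IsNoetherianRing R'] [IsAdicComplete (maximalIdeal R') R']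
  (aug' : R' →ₐ[k] k) (ξ' : ∀ n, (localHilbertFunctor X ι₀.ker).obj (ArtAlg.ofPowQuotient R' aug' n))
  {G : ArtinFunctor.{u} k} (ν : ∀ R : ArtAlg.{u} k, (localHilbertFunctor X ι₀.ker).obj R → G.obj R)

/-- **[BuchweitzFlenner2003, Thm. 7.9 (2)] SHAPE for EVERY hull, from the KERNEL PRINCIPLE**: `θ : H¹(Z, 𝒩_{Z/X}) → W` compatible with `ν : H_Z^X → G` and an
obstruction theory of a functor `G` smooth on small extensions, `dim_k ker θ < ∞` ⇒ every hull `(R′, ξ̂′)` of `H_Z^X` has **`h⁰(Z, 𝒩_{Z/X}) ≤ dim R′ + dim_k ker θ`**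
(tree `localHilbertFunctor_isHull_dimension_bound_of_annihilates_of_isRegularImmersionOfCodim` + `localHilbertFunctor_annihilates_of_isCompatible`).
[cite: BuchweitzFlenner2003, Thm. 7.9 (2), Rem. 7.11 (1)] [cite: IaconoManetti2013SemiregularityCI, §6 (p. 14)] [cite: Schlessinger1968, Prop. 2.9] [cite: Hartshorne2010, §15 Ex. 15.5 (b)] -/
theorem localHilbertFunctor_isHull_dimension_bound_of_isCompatible {W : Type u} [AddCommGroup W] [Module k W] (OG : G.ObstructionTheory W)
    (θ : letI := normalCohomologyModuleK X ι₀ 1; HodgeTheory.normalSheafCohomology ι₀ 1 →ₗ[k] W)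
    (hfin : letI := normalCohomologyModuleK X ι₀ 1; FiniteDimensional k (LinearMap.ker θ))
    (hc : letI := normalCohomologyModuleK X ι₀ 1
      (localHilbertFunctor.normalObstructionTheoryOfRegularImmersion X ι₀ hreg).IsCompatible ν OG θ) (hG : G.IsSmoothSmall)
    (hR' : Formal.IsHull (localHilbertFunctor X ι₀.ker) R' aug' ξ') :
    letI := normalCohomologyModuleK X ι₀ 0; letI := normalCohomologyModuleK X ι₀ 1
    (Module.finrank k (HodgeTheory.normalSheafCohomology ι₀ 0) : WithBot ℕ∞) ≤ ringKrullDim R' + Module.finrank k (LinearMap.ker θ) := by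
  letI := normalCohomologyModuleK X ι₀ 0; letI := normalCohomologyModuleK X ι₀ 1
  exact localHilbertFunctor_isHull_dimension_bound_of_annihilates_of_isRegularImmersionOfCodim X ι₀ R' aug' ξ' hreg θ hfin
    (localHilbertFunctor_annihilates_of_isCompatible X ι₀ hreg ν OG θ hc hG) hR'

/-- **«If the semiregularity map is injective, then the Hilbert scheme is smooth at `Z`» read on EVERY hull** ([IaconoManetti2013SemiregularityCI, Introduction];
[BuchweitzFlenner2003, Thm. 7.9]; [Schlessinger1968, Remark 2.10]): `θ` INJECTIVE and compatible towards an unobstructed `G` ⇒ every hull `R′` of `H_Z^X` has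
**`dim R′ = h⁰(Z, 𝒩_{Z/X})`** and `H_Z^X` is smooth (tree `localHilbertFunctor_isSmooth_of_isCompatible_of_injective` + `localHilbertFunctor_isSmooth_iff_ringKrullDim_hull_eq_normalH0`).
[cite: IaconoManetti2013SemiregularityCI, Introduction (p. 2)] [cite: BuchweitzFlenner2003, Thm. 7.9 (2), Cor. 7.10] [cite: Schlessinger1968, Remark 2.10 (p. 212), Prop. 2.9] -/
theorem localHilbertFunctor_isHull_ringKrullDim_eq_of_isCompatible_of_injective {W : Type u} [AddCommGroup W] [Module k W]
    (OG : G.ObstructionTheory W) (θ : letI := normalCohomologyModuleK X ι₀ 1; HodgeTheory.normalSheafCohomology ι₀ 1 →ₗ[k] W)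
    (hc : letI := normalCohomologyModuleK X ι₀ 1
      (localHilbertFunctor.normalObstructionTheoryOfRegularImmersion X ι₀ hreg).IsCompatible ν OG θ) (hG : G.IsSmoothSmall)
    (hinj : Function.Injective θ) (hR' : Formal.IsHull (localHilbertFunctor X ι₀.ker) R' aug' ξ') :
    letI := normalCohomologyModuleK X ι₀ 0
    ringKrullDim R' = Module.finrank k (HodgeTheory.normalSheafCohomology ι₀ 0) ∧ (localHilbertFunctor X ι₀.ker).IsSmooth := by
  letI := normalCohomologyModuleK X ι₀ 0; letI := normalCohomologyModuleK X ι₀ 1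
  have hs : (localHilbertFunctor X ι₀.ker).IsSmooth := localHilbertFunctor_isSmooth_of_isCompatible_of_injective X ι₀ hreg ν OG θ hc hG hinj
  exact ⟨(localHilbertFunctor_isSmooth_iff_ringKrullDim_hull_eq_normalH0 X ι₀ R' aug' ξ' hR').1 hs, hs⟩

/-- **[Ran1993HodgeHilbertScheme, (3) + Cor. 2] SHAPE per component of EVERY hull, from the KERNEL PRINCIPLE**: every minimal prime `𝔭` of a hull `R′` of `H_Z^X`
has **`h⁰(Z, 𝒩_{Z/X}) ≤ dim (R′/𝔭) + dim_k ker θ`** (tree `localHilbertFunctor_isHull_component_dimension_bound_of_annihilates_of_isRegularImmersionOfCodim`).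
[cite: Ran1993HodgeHilbertScheme, (3) and Cor. 2 (proof p. 194)] [cite: IaconoManetti2013SemiregularityCI, §6 (p. 14)] [cite: BuchweitzFlenner2003, Thm. 7.9 (2)] [cite: Schlessinger1968, Prop. 2.9] -/
theorem localHilbertFunctor_isHull_component_dimension_bound_of_isCompatible {W : Type u} [AddCommGroup W] [Module k W]
    (OG : G.ObstructionTheory W) (θ : letI := normalCohomologyModuleK X ι₀ 1; HodgeTheory.normalSheafCohomology ι₀ 1 →ₗ[k] W)
    (hfin : letI := normalCohomologyModuleK X ι₀ 1; FiniteDimensional k (LinearMap.ker θ))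
    (hc : letI := normalCohomologyModuleK X ι₀ 1
      (localHilbertFunctor.normalObstructionTheoryOfRegularImmersion X ι₀ hreg).IsCompatible ν OG θ) (hG : G.IsSmoothSmall)
    (hR' : Formal.IsHull (localHilbertFunctor X ι₀.ker) R' aug' ξ') {𝔭 : Ideal R'} (h𝔭 : 𝔭 ∈ minimalPrimes R') :
    letI := normalCohomologyModuleK X ι₀ 0; letI := normalCohomologyModuleK X ι₀ 1
    (Module.finrank k (HodgeTheory.normalSheafCohomology ι₀ 0) : WithBot ℕ∞) ≤ ringKrullDim (R' ⧸ 𝔭) + Module.finrank k (LinearMap.ker θ) := by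
  letI := normalCohomologyModuleK X ι₀ 0; letI := normalCohomologyModuleK X ι₀ 1
  exact localHilbertFunctor_isHull_component_dimension_bound_of_annihilates_of_isRegularImmersionOfCodim X ι₀ R' aug' ξ' hreg θ hfin
    (localHilbertFunctor_annihilates_of_isCompatible X ι₀ hreg ν OG θ hc hG) hR' h𝔭

end AnyHull

section AnyHullZero

variable {k : Type} [Field k] (X : Motives.SchemeOver k) {Z : Scheme.{0}} (ι₀ : Z ⟶ X.left) [IsClosedImmersion ι₀]
  [IsLocallyNoetherian X.left] [IsProper (ι₀ ≫ X.hom)] [Nonempty Z] {c : ℕ} (hreg : HodgeTheory.IsRegularImmersionOfCodim ι₀ c)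
  (R' : Type) [CommRing R'] [Algebra k R'] [IsLocalRing R'] [IsNoetherianRing R'] [IsAdicComplete (maximalIdeal R') R']
  (aug' : R' →ₐ[k] k) (ξ' : ∀ n, (localHilbertFunctor X ι₀.ker).obj (ArtAlg.ofPowQuotient R' aug' n))
  {G : ArtinFunctor.{0} k} (ν : ∀ R : ArtAlg.{0} k, (localHilbertFunctor X ι₀.ker).obj R → G.obj R)

/-- **[Ran1993HodgeHilbertScheme, (3) + Cor. 2] in the PRINTED RANK FORM «`dim ℋ ≥ h⁰(N) − h¹(N) + dim im(π)`» per component of EVERY hull, from the KERNEL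
PRINCIPLE** (universe `0`, `h¹ < ∞` automatic): **`h⁰(Z, 𝒩_{Z/X}) + rk θ ≤ dim (R′/𝔭) + h¹(Z, 𝒩_{Z/X})`** for every hull `R′`, every minimal prime `𝔭`, every `θ`
compatible towards an unobstructed `G` (tree `localHilbertFunctor_isHull_component_dimension_bound_rank_of_annihilates`).
[cite: Ran1993HodgeHilbertScheme, (3) p. 191 and Cor. 2 p. 192] [cite: IaconoManetti2013SemiregularityCI, §6 (p. 14)] [cite: BuchweitzFlenner2003, Thm. 7.9 (2)] -/
theorem localHilbertFunctor_isHull_component_dimension_bound_rank_of_isCompatible {W : Type} [AddCommGroup W] [Module k W]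
    (OG : G.ObstructionTheory W) (θ : letI := normalCohomologyModuleK X ι₀ 1; HodgeTheory.normalSheafCohomology ι₀ 1 →ₗ[k] W)
    (hc : letI := normalCohomologyModuleK X ι₀ 1
      (localHilbertFunctor.normalObstructionTheoryOfRegularImmersion X ι₀ hreg).IsCompatible ν OG θ) (hG : G.IsSmoothSmall)
    (hR' : Formal.IsHull (localHilbertFunctor X ι₀.ker) R' aug' ξ') {𝔭 : Ideal R'} (h𝔭 : 𝔭 ∈ minimalPrimes R') :
    letI := normalCohomologyModuleK X ι₀ 0; letI := normalCohomologyModuleK X ι₀ 1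
    (Module.finrank k (HodgeTheory.normalSheafCohomology ι₀ 0) : WithBot ℕ∞) + Module.finrank k (LinearMap.range θ) ≤
      ringKrullDim (R' ⧸ 𝔭) + Module.finrank k (HodgeTheory.normalSheafCohomology ι₀ 1) := by
  letI := normalCohomologyModuleK X ι₀ 0; letI := normalCohomologyModuleK X ι₀ 1
  exact localHilbertFunctor_isHull_component_dimension_bound_rank_of_annihilates X ι₀ R' aug' ξ' hreg θ
    (localHilbertFunctor_annihilates_of_isCompatible X ι₀ hreg ν OG θ hc hG) hR' h𝔭

end AnyHullZero

end Literature.AlgebraicGeometry.Deformation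

/-! ## §2 Over `ℂ`, `X` smooth projective, `Z ↪ X` a regular immersion of codimension `p`: every hull -/

namespace Literature.AlgebraicGeometry.HodgeTheory

open Literature.AlgebraicGeometry.Deformation Literature.AlgebraicGeometry.Motives IsLocalRing

/-- **[BuchweitzFlenner2003, Thm. 7.9 (2)] ∕ «semiregular ⇒ `Hilb` smooth at `Z`» on EVERY hull `(R′, ξ̂′)` of the local Hilbert functor, with the map and the target
functor ABSTRACT** (`X` smooth projective over `ℂ` of dimension `m`, `ι₀ : Z → X` a regular immersion of codimension `p`, `Z ≠ ∅`; `G` smooth on small extensions,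
`ν : H_Z^X → G`, `(W, w_e)` an obstruction theory of `G`, `θ : H¹(Z, 𝒩_{Z/X}) → W` compatible with `dim ker θ < ∞`): `dim R′` is a natural number `d` with
**`h⁰(Z, 𝒩_{Z/X}) ≤ d + dim ker θ`**, and if `θ` is INJECTIVE then **`d = h⁰(Z, 𝒩_{Z/X})`** (the tree's fact `Bloch1972_hilbertScheme_smoothAt_semiregular` is NOT used).
[cite: BuchweitzFlenner2003, Thm. 7.9 (2), Cor. 7.10, Rem. 7.11 (1)] [cite: IaconoManetti2013SemiregularityCI, Introduction (p. 2) and §6] [cite: Schlessinger1968, Remark 2.10, Prop. 2.9]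
[cite: BandieraLepriManetti2023, Cor. 1.2] -/
theorem localHilbertFunctor_isHull_dimension_bound_of_isCompatible_smoothProjective
    {X : Motives.SchemeOver ℂ} {m p : ℕ} (hX : Motives.IsSmoothProjective m X) {Z : Scheme.{0}} {ι₀ : Z ⟶ X.left}
    (hι : IsRegularImmersionOfCodim ι₀ p) [Nonempty Z] {G : ArtinFunctor.{0} ℂ}
    (ν : haveI := hι.isClosedImmersion; ∀ R : ArtAlg.{0} ℂ, (localHilbertFunctor X ι₀.ker).obj R → G.obj R)
    {W : Type} [AddCommGroup W] [Module ℂ W] (OG : G.ObstructionTheory W)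
    (θ : haveI := hι.isClosedImmersion; letI := normalCohomologyModuleK X ι₀ 1; normalSheafCohomology ι₀ 1 →ₗ[ℂ] W)
    (hfin : haveI := hι.isClosedImmersion; letI := normalCohomologyModuleK X ι₀ 1; FiniteDimensional ℂ (LinearMap.ker θ))
    (hc : haveI := hι.isClosedImmersion; letI := normalCohomologyModuleK X ι₀ 1
      haveI : IsLocallyNoetherian X.left := IsSmoothProjective.isLocallyNoetherian_holds hX
      (localHilbertFunctor.normalObstructionTheoryOfRegularImmersion X ι₀ hι).IsCompatible ν OG θ)
    (hG : G.IsSmoothSmall)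
    (R' : Type) [CommRing R'] [Algebra ℂ R'] [IsLocalRing R'] [IsNoetherianRing R'] [IsAdicComplete (maximalIdeal R') R']
    (aug' : R' →ₐ[ℂ] ℂ) (ξ' : haveI := hι.isClosedImmersion; ∀ j, (localHilbertFunctor X ι₀.ker).obj (ArtAlg.ofPowQuotient R' aug' j))
    (hR' : haveI := hι.isClosedImmersion; Formal.IsHull (localHilbertFunctor X ι₀.ker) R' aug' ξ') :
    haveI := hι.isClosedImmersion; letI := normalCohomologyModuleK X ι₀ 0; letI := normalCohomologyModuleK X ι₀ 1
    ∃ d : ℕ, ringKrullDim R' = d ∧ Module.finrank ℂ (normalSheafCohomology ι₀ 0) ≤ d + Module.finrank ℂ (LinearMap.ker θ) ∧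
      (Function.Injective θ → d = Module.finrank ℂ (normalSheafCohomology ι₀ 0)) := by
  haveI := hι.isClosedImmersion
  haveI : IsLocallyNoetherian X.left := IsSmoothProjective.isLocallyNoetherian_holds hX
  haveI : IsProper X.hom := IsSmoothProjective.isProper_holds hX
  letI := normalCohomologyModuleK X ι₀ 0; letI := normalCohomologyModuleK X ι₀ 1
  obtain ⟨d, hd, -, -, -, -⟩ := localHilbertFunctor_isHull_dimension_bound_smoothProjective hX hι θ
    (localHilbertFunctor_annihilates_of_isCompatible X ι₀ hι ν OG θ hc hG) R' aug' ξ' hR'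
  have hker := localHilbertFunctor_isHull_dimension_bound_of_isCompatible X ι₀ hι R' aug' ξ' ν OG θ hfin hc hG hR'
  refine ⟨d, hd, ?_, fun hinj => ?_⟩
  · rw [hd] at hker; exact_mod_cast hker
  · have h := (localHilbertFunctor_isHull_ringKrullDim_eq_of_isCompatible_of_injective X ι₀ hι R' aug' ξ' ν OG θ hc hG hinj hR').1
    rw [hd] at h; exact_mod_cast h

end Literature.AlgebraicGeometry.HodgeTheory

end
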